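import Summits.ResolutionOfSingularities.ResolutionOfSingularities.Theorems.FrobeniusClosingPatchingRelPerfectChartTransversalValues
import Summits.ResolutionOfSingularities.ResolutionOfSingularities.Theorems.FrobeniusClosingPatchingRelPerfectPairSwap
import HarnessLib

/-!
# Crux `PatchingRelPerfect` (stmt-ResolutionOfSingularities-16161), chain w52 — rung toolkit:
# the codimension-two chart quotients as a PACKAGE under pair hypotheses only (three-letter step,
# brick 6: «pairs instead of domains»)

[OURS · L1 W5.2 · rung tool] Bricks 2–4 (`…ChartPrincipalStrict`, `…ChartTransversalPair`,
`…ChartTransversalValues`) assumed `A/(t)` a DOMAIN to identify, on the `ℓ`-chart `C` of `Bl_{(t,ℓ)}`,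
`C/(u') ≅ A/(t)` and `C/(u', φ o) ≅ A/(t, o)`.  Integrality of the hyperplane `V(t)` is NOT available
for the contact-migration member (there `t` is the strict transform of `V(x₀x₁ + x₂² + x₃³)` over an
arbitrary regular local base; this seat's PLAN-A2-certificate.md, addendum 2), but it is also not
needed: the only use was that `ℓ̄` be a non-zero-divisor of `A/(t)`, i.e. that `[t, ℓ]` be a weakly
regular pair.  PROVED here under that hypothesis (`A/(t, ℓ)` a domain, `(t, ℓ)` quasi-regular):

* `pairs_quot_package` — isomorphisms `E₁ : C/(u') ≅ A/(t)` WITH VALUES `[φ r] ↦ [r]` and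
  `E₂ : C/((u') + (φ o)) ≅ A/((t) + (o))` (existence);
* `pairs_isSMulRegular_transport` — `o` regular modulo `t` ⇒ `φ o` regular modulo `u'`;
* `pairs_chartGen_mem_nonZeroDivisors` — `u'` is a non-zero-divisor of the chart (`A` a domain);
* `pairs_isWeaklyRegular_c'o'`, `pairs_isWeaklyRegular_c'ℓ'` — the two next pairs, from `[t, o]`
  resp. by swapping the chart family `[ℓ', u']` (`isWeaklyRegular_pair_swap`).

Arbitrary commutative rings; nothing here is a statement of the manuscript under review.

## References

* The Stacks Project, Tags 0804, 0BIQ. [StacksProject]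
* U. Görtz, T. Wedhorn, *Algebraic Geometry I*, 2nd ed. 2020, Prop. 13.96 (2), (13.19). [GortzWedhorn2020]
* H. Matsumura, *Commutative Ring Theory*, CUP 1986, Thm. 16.2 (i). [Matsumura1987]
-/

-- `Summit.<Summit>.<Sub>.Theorems` with `Sub = Summit` (single-conjunct summit, D-0017)
set_option linter.dupNamespace false

noncomputable section

open CategoryTheory CategoryTheory.Limits AlgebraicGeometry Literature.AlgebraicGeometry.Resolution
open IsLocalRing

namespace Summit.ResolutionOfSingularities.ResolutionOfSingularities.Theorems

namespace ConeRung

universe u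

/-- **`R[I/b] ≅ R` with values** when `I ⊆ (b)` and `b` is a non-zero-divisor: `algebraMap x ↦ x`.
[cite: GortzWedhorn2020, (13.19) p. 415] -/
theorem bot_blowupAlgebra_exists_equiv {R : Type u} [CommRing R] (I : Ideal R) (b : R)
    (hb : b ∈ nonZeroDivisors R) (h : I ≤ Ideal.span {b}) :
    ∃ e : blowupAlgebra I b ≃+* R, ∀ x : R, e (algebraMap R (blowupAlgebra I b) x) = x := by
  have hinj : Function.Injective (algebraMap R (Localization.Away b)) :=
    IsLocalization.injective (Localization.Away b) (Submonoid.powers_le.mpr hb)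
  let e0 : blowupAlgebra I b ≃ₐ[R] (⊥ : Subalgebra R (Localization.Away b)) :=
    Subalgebra.equivOfEq _ _ (blowupAlgebra_eq_bot_of_le_span I b h)
  let e1 : (⊥ : Subalgebra R (Localization.Away b)) ≃ₐ[R] R := Algebra.botEquivOfInjective hinj
  refine ⟨(e0.trans e1).toRingEquiv, fun x => ?_⟩
  change (e0.trans e1) (algebraMap R (blowupAlgebra I b) x) = x
  rw [AlgEquiv.commutes]
  rfl

section CodimTwo

variable {A : Type u} [CommRing A] (t ℓ o : A)

local notation3 "cc" => (Fin.cons t (fun _ : Fin 1 => ℓ) : Fin 2 → A)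
local notation3 "II" => Ideal.span (Set.range (Fin.cons t (fun _ : Fin 1 => ℓ) : Fin 2 → A))
local notation3 "C" => chartRing cc (Fin.succ 0)
local notation3 "ψ" => chartBase cc (Fin.succ 0)
local notation3 "ℓ'" => chartBase cc (Fin.succ 0) (cc (Fin.succ 0))
local notation3 "u'" => chartGen cc (Fin.succ 0) 0

/-- **The chart-quotient package under pair hypotheses**: `E₁ : C/(u') ≅ A/(t)` with `[φ r] ↦ [r]`, and
`E₂ : C/((u') + (φ o)) ≅ A/((t) + (o))`, assuming only `(t, ℓ)` quasi-regular, `A/(t, ℓ)` a domain and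
`ℓ̄` a non-zero-divisor of `A/(t)`. [cite: GortzWedhorn2020, Prop. 13.96 (2)] [cite: StacksProject, Tag 0804] -/
theorem pairs_quot_package (hc : IsQuasiRegular cc) [IsDomain (A ⧸ II)]
    (hℓt : Ideal.Quotient.mk (Ideal.span {t}) ℓ ∈ nonZeroDivisors (A ⧸ Ideal.span {t})) :
    ∃ (E₁ : (C ⧸ Ideal.span {u'}) ≃+* (A ⧸ Ideal.span {t}))
      (_ : (C ⧸ (Ideal.span {u'} ⊔ Ideal.span {ψ o})) ≃+* (A ⧸ (Ideal.span {t} ⊔ Ideal.span {o}))),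
      ∀ r : A, E₁ (Ideal.Quotient.mk _ (ψ r)) = Ideal.Quotient.mk (Ideal.span {t}) r := by
  obtain ⟨e, he⟩ := strictExc_exists_quot_equiv t (fun _ : Fin 1 => ℓ) 0 hc
  have hℓt' : Ideal.Quotient.mk (Ideal.span {t}) (cc (Fin.succ 0)) ∈ nonZeroDivisors (A ⧸ Ideal.span {t}) := by
    rwa [Fin.cons_succ]
  obtain ⟨eb, heb⟩ := bot_blowupAlgebra_exists_equiv ((II).map (Ideal.Quotient.mk (Ideal.span {t}))) _
    hℓt' (map_span_pair_le_span t ℓ)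
  let E₁ : (C ⧸ Ideal.span {u'}) ≃+* (A ⧸ Ideal.span {t}) := e.trans eb
  have hE₁ : ∀ r : A, E₁ (Ideal.Quotient.mk _ (ψ r)) = Ideal.Quotient.mk (Ideal.span {t}) r := fun r => by
    change eb (e (Ideal.Quotient.mk _ (ψ r))) = _
    rw [he, heb]
  -- `E₂`: `C/((u') + (φ o)) ≅ (C/(u'))/(φ o) ≅ (A/(t))/(ō) ≅ A/((t) + (o))`
  let e1 := (DoubleQuot.quotQuotEquivQuotSup (Ideal.span {u'}) (Ideal.span {ψ o})).symm
  let e3 := Ideal.quotientEquiv ((Ideal.span {ψ o}).map (Ideal.Quotient.mk (Ideal.span {u'})))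
    ((Ideal.span {o}).map (Ideal.Quotient.mk (Ideal.span {t}))) E₁
    (by
      rw [Ideal.map_span _ ({ψ o} : Set C), Set.image_singleton,
        Ideal.map_span _ ({Ideal.Quotient.mk (Ideal.span {u'}) (ψ o)} : Set (C ⧸ Ideal.span {u'})),
        Set.image_singleton, Ideal.map_span _ ({o} : Set A), Set.image_singleton]
      change _ = Ideal.span {E₁ (Ideal.Quotient.mk _ (ψ o))}
      rw [hE₁])
  let e4 := DoubleQuot.quotQuotEquivQuotSup (Ideal.span {t}) (Ideal.span {o})
  exact ⟨E₁, e1.trans (e3.trans e4), hE₁⟩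

/-- **Transport of regularity modulo the hyperplane**: if `o` is regular modulo `t` on `A`, then `φ o`
is regular modulo `u'` on the chart. [cite: Matsumura1987, Thm. 16.2 (i)] -/
theorem pairs_isSMulRegular_transport (hc : IsQuasiRegular cc) [IsDomain (A ⧸ II)]
    (hℓt : Ideal.Quotient.mk (Ideal.span {t}) ℓ ∈ nonZeroDivisors (A ⧸ Ideal.span {t}))
    (hot : IsSMulRegular (A ⧸ Ideal.span {t}) o) : IsSMulRegular (C ⧸ Ideal.span {u'}) (ψ o) := by
  obtain ⟨E₁, -, hE₁⟩ := pairs_quot_package t ℓ o hc hℓt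
  rw [isSMulRegular_quot_span_iff] at hot ⊢
  intro y hy
  have h1 : Ideal.Quotient.mk (Ideal.span {u'}) (ψ o * y) = 0 := Ideal.Quotient.eq_zero_iff_mem.mpr hy
  have h2 := congrArg E₁ h1
  rw [map_mul, map_zero, map_mul, hE₁] at h2
  obtain ⟨a, ha⟩ := Ideal.Quotient.mk_surjective (E₁ (Ideal.Quotient.mk _ y))
  rw [← ha, ← map_mul, Ideal.Quotient.eq_zero_iff_mem] at h2
  have h3 : Ideal.Quotient.mk (Ideal.span {t}) a = 0 := Ideal.Quotient.eq_zero_iff_mem.mpr (hot a h2)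
  rw [h3] at ha
  have h4 : E₁ (Ideal.Quotient.mk _ y) = 0 := ha.symm
  rw [map_eq_zero_iff _ E₁.injective] at h4
  exact Ideal.Quotient.eq_zero_iff_mem.mp h4

/-- An element whose image under a ring isomorphism onto a domain is non-zero is a
non-zero-divisor. [folklore] -/
theorem mem_nonZeroDivisors_of_equiv {X Y : Type*} [CommRing X] [CommRing Y] [IsDomain Y]
    (e : X ≃+* Y) {a : X} (ha : e a ≠ 0) : a ∈ nonZeroDivisors X :=
  mem_nonZeroDivisors_iff_right.mpr fun y hy => by
    apply e.injective
    have h := congrArg e hy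
    rw [map_mul, map_zero] at h
    rw [map_zero]
    rcases mul_eq_zero.mp h with h1 | h1
    · exact h1
    · exact absurd h1 ha

/-- `u'` is a non-zero-divisor of the chart (`Φ(u') ≠ 0` in the domain `A[(t,ℓ)/ℓ]`). [folklore] -/
theorem pairs_chartGen_mem_nonZeroDivisors [IsDomain A] (hc : IsQuasiRegular cc)
    [Nontrivial (A ⧸ II)] (hℓ0 : ℓ ≠ 0) : u' ∈ nonZeroDivisors C := by
  have hvk0 : cc (Fin.succ 0) ≠ 0 := by rwa [Fin.cons_succ]
  haveI : IsDomain (Localization.Away (cc (Fin.succ 0))) :=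
    IsLocalization.isDomain_localization (powers_le_nonZeroDivisors_of_noZeroDivisors hvk0)
  haveI : IsDomain (blowupAlgebra (II) (cc (Fin.succ 0))) := inferInstance
  refine mem_nonZeroDivisors_of_equiv
    (reesChartEquiv (I := II) (cc (Fin.succ 0))
      (Ideal.mem_span_range_self (f := cc) (x := Fin.succ 0))) ?_
  exact strictExc_equiv_chartGen_ne_zero t (fun _ : Fin 1 => ℓ) 0 hc

/-- **The next pair `[u', φ o]` is weakly regular** on the chart when `[t, o]` is a weakly regular pair
of `A` (i.e. `o` regular modulo `t`), `A` a domain, `ℓ ≠ 0`. [cite: Matsumura1987, Thm. 16.2 (i)] -/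
theorem pairs_isWeaklyRegular_c'o' [IsDomain A] (hc : IsQuasiRegular cc) [IsDomain (A ⧸ II)]
    (hℓt : Ideal.Quotient.mk (Ideal.span {t}) ℓ ∈ nonZeroDivisors (A ⧸ Ideal.span {t}))
    (hot : IsSMulRegular (A ⧸ Ideal.span {t}) o) (hℓ0 : ℓ ≠ 0) :
    RingTheory.Sequence.IsWeaklyRegular C (List.ofFn (Fin.cons u' fun _ : Fin 1 => ψ o)) := by
  rw [isWeaklyRegular_pair_iff]
  exact ⟨(isRegular_iff_mem_nonZeroDivisors.mpr
      (pairs_chartGen_mem_nonZeroDivisors t ℓ hc hℓ0)).left.isSMulRegular,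
    pairs_isSMulRegular_transport t ℓ o hc hℓt hot⟩

/-- **The next pair `[u', ℓ']` is weakly regular** (swap of the chart family `[ℓ', u']`), `A` a domain,
`ℓ ≠ 0`. [cite: Matsumura1987, Thm. 16.2 (i)] -/
theorem pairs_isWeaklyRegular_c'ℓ' [IsDomain A] (hc : IsQuasiRegular cc) [Nontrivial (A ⧸ II)]
    (hℓ0 : ℓ ≠ 0) :
    RingTheory.Sequence.IsWeaklyRegular C (List.ofFn (Fin.cons u' fun _ : Fin 1 => ℓ')) := by
  have h := CoreRungTower.isWeaklyRegular_chartFamily cc (Fin.succ 0)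
    (fun _ : Fin 1 => (⟨0, (Fin.succ_ne_zero 0).symm⟩ : {l : Fin 2 // l ≠ Fin.succ 0})) hc
    (Function.injective_of_subsingleton _)
  exact isWeaklyRegular_pair_swap ℓ' u'
    (reesChartBase_mem_nonZeroDivisors (cc (Fin.succ 0))
      (Ideal.mem_span_range_self (f := cc) (x := Fin.succ 0)))
    (pairs_chartGen_mem_nonZeroDivisors t ℓ hc hℓ0) h

end CodimTwo

end ConeRung

end Summit.ResolutionOfSingularities.ResolutionOfSingularities.Theorems

end
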